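import Literature.NumberTheory.Automorphic.CDTTheorem722
import Literature.NumberTheory.Automorphic.CDTTheorem722SerreProofs
import Literature.NumberTheory.Automorphic.ShimuraCurveRibetTakahashiPeterssonTwistComparisonProofs
import Literature.NumberTheory.EllipticCurves.NewformsTwistPacketProofs
import Literature.NumberTheory.EllipticCurves.QuadraticTwistNegOneLFunctionProofs
import Literature.NumberTheory.EllipticCurves.IsogenyFrobeniusTraceHoldsProofs
import Literature.NumberTheory.EllipticCurves.LFunctionSmulProofs
import Literature.NumberTheory.EllipticCurves.SzpiroOfAbcProofs
import Literature.NumberTheory.EllipticCurves.SzpiroFreyConductorProofs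
import Literature.NumberTheory.DiophantineGeometry.PastenValuationProductsProofs
import Literature.NumberTheory.DiophantineGeometry.GeneralizedFermatTwoPowerCoefficientFreyProofs
import Literature.NumberTheory.DiophantineGeometry.FreyCurveConductorTwoTwistDichotomyProofs
import HarnessLib

/-!
# Stub-ideation companion (k = 3, GEN 3 — family "probe the extremes") for `stub_liftFive`

Crux `FreyModularity` (stmt-ABC-11340), line `Sketch`.  Elaboration-checked statements for the plan
`STUB-IDEAS-stub_liftFive-3.md` (gen 3):

* §1 `LiftFiveSemistable` — the stub RE-CUT to the minimal generality its ONLY consumer (case B of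
  `isModular_freyCurve_of_stubs`) uses, in CONGRUENCE form: a SEMISTABLE curve `E` whose `E[5]` is
  irreducible and isomorphic to `E'[5]` for a modular curve `E'` has modular `ρ_{E,5}`.  Printed engine:
  Darmon–Diamond–Taylor 1995, Cor. 3.46 at `ℓ = 5` (Wiles 1995 Thm. 0.2 + Taylor–Wiles; no "abs. irreducible
  over `ℚ(√5)`" hypothesis — DDT Lemma 3.24 — and no Diamond-1996 local conditions).  Kernel-checked:
  `LiftFiveSemistable ⇐ stub_liftFive-shape ⇐ CDT_theorem_7_2_2` (§1), so the re-cut never loses a closer.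
* §2 helpers: H1 normalisation of a case-B Frey curve WITH the explicit `ℚ`-isomorphism / `−1`-twist
  relation (proved here), H2 = the tree's `isModular_smul_iff`, H3 `BCDT.IsModular` is invariant under the
  `−1` twist GRANTED Eichler–Shimura + Carayol (the two facts S9 already carries) — proved here from the
  Atkin–Li twist packet and the tree's three-facts Faltings–Serre lemma.
* §3 the re-glued case analysis, kernel-checked: helpers + `LiftFiveSemistable` + the other registered
  stub shapes ⇒ every Frey curve is `BCDT.IsModular` — the right-hand side, verbatim, of the landed
  `Summit.ABC.ABC.Theorems.freyModularity_iff_forall_isModular_freyCurve`, whose `.mpr` is the crux BY NAME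
  (as in the skeleton's `FreyModularity_of`).  Imports are Literature-only because the `DefiniteXi…`
  summit modules are `remote:stale:…:unbuilt` on the farm snapshot today; the landed summit facts used
  (S4b, S10, S12, case-B transports) enter as hypotheses in their registered shapes.

Only `sorry`s: `stub_liftFiveSemistable` (the XL engine) and the optional `stub_liftFiveSemistableOrdinary`;
`forall_isModular_freyCurve_of_semistable_recut` depends on `[propext, Classical.choice, Quot.sound]` only.
-/

noncomputable section

open scoped MatrixGroups NumberField
open Literature.NumberTheory.EllipticCurves
open Literature.NumberTheory.EllipticCurves.ModularForms
open Literature.NumberTheory.Automorphic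
open Literature.NumberTheory.Automorphic.BCDT
open Literature.NumberTheory.GaloisRepresentations
open Literature.NumberTheory.DiophantineGeometry
open WeierstrassCurve IsDedekindDomain

namespace Summit.ABC.ABC.Cruxes.FreyModularity.StubIdeas.LiftFive3g3

/-! ## §1 The re-cut stub: semistable congruence form (DDT 1995 Cor. 3.46 at `ℓ = 5`) -/

/-- **`LiftFiveSemistable` (proposed new shape of S2).**  For elliptic `W, W'/ℚ` and a framed model `ρ̄`
of BOTH `W[5]` and `W'[5]`: if `W` is semistable, `ρ̄` is irreducible and `W'` is modular, then
`ρ_{W,5}` is modular.  Darmon–Diamond–Taylor 1995 Cor. 3.46 (`ℓ = 5`, `ρ = ρ_{W,5}`: unipotent inertia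
at `p ≠ 5` and semistability at `5` from `W` semistable, `det = ε`; `ρ̄` modular of weight 2 from `W'`);
= the second half of Wiles 1995, proof of Thm. 5.2.
[cite: DarmonDiamondTaylor1995, Cor. 3.46] [cite: Wiles1995Annals, Thm. 0.2, Thm. 5.2 (proof)] -/
def LiftFiveSemistable : Prop :=
  ∀ (W W' : WeierstrassCurve ℚ) [W.IsElliptic] [W'.IsElliptic] [NeZero (W'.conductorNorm ℤ)]
    (ρ : ModPGaloisRep ℚ (ZMod 5) 2),
    W.IsSemistable ℤ → W.IsTorsionGaloisRep 5 ρ → W'.IsTorsionGaloisRep 5 ρ →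
    FramedRep.IsIrreducible ρ → BCDT.IsModular W' → W.IsModularGaloisRepTate 5

/-- **`LiftFiveSemistableOrdinary` (optional further cut, SigB⁺).**  Same, for `W` semistable AND
multiplicative at `5` (`5 ∣ N_W`): the ordinary case of Wiles 1995 Ch. 1–3 only (no flat deformations).
Costs the extra glue lemma "case B ⇒ `5 ∣ abc`" (gen-2 plan G1core). [cite: Wiles1995Annals, Thm. 0.2 (I)] -/
def LiftFiveSemistableOrdinary : Prop :=
  ∀ (W W' : WeierstrassCurve ℚ) [W.IsElliptic] [W'.IsElliptic] [NeZero (W'.conductorNorm ℤ)]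
    (ρ : ModPGaloisRep ℚ (ZMod 5) 2),
    W.IsSemistable ℤ → 5 ∣ W.conductorNorm ℤ → W.IsTorsionGaloisRep 5 ρ → W'.IsTorsionGaloisRep 5 ρ →
    FramedRep.IsIrreducible ρ → BCDT.IsModular W' → W.IsModularGaloisRepTate 5

/-- The proposed stub (XL; closed by a Literature typing of DDT §§2–3 in the semistable case, or by
`CDT_theorem_7_2_2` as today, `liftFiveSemistable_of_CDT_theorem_7_2_2`). -/
theorem stub_liftFiveSemistable : LiftFiveSemistable := by
  sorry

/-- The optional ordinary-only stub. -/
theorem stub_liftFiveSemistableOrdinary : LiftFiveSemistableOrdinary := by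
  sorry

/-- `25 ∤ N` (indeed no square of a prime divides `N`) for a semistable curve: squarefree conductor.
[folklore] -/
theorem not_twentyFive_dvd_of_isSemistable (W : WeierstrassCurve ℚ) [W.IsElliptic]
    (h : W.IsSemistable ℤ) : ¬ 25 ∣ W.conductorNorm ℤ := by
  intro h25
  have hsq : Squarefree (W.conductorNorm ℤ) := (isSemistable_iff_squarefree_conductorNorm W).mp h
  have h5 : IsUnit (5 : ℕ) := hsq 5 ((show (5 : ℕ) * 5 = 25 by norm_num) ▸ h25)
  exact absurd (Nat.isUnit_iff.mp h5) (by norm_num)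

/-- `9 ∤ N` for a semistable curve. [folklore] -/
theorem not_nine_dvd_of_isSemistable (W : WeierstrassCurve ℚ) [W.IsElliptic]
    (h : W.IsSemistable ℤ) : ¬ 9 ∣ W.conductorNorm ℤ := by
  intro h9
  have hsq : Squarefree (W.conductorNorm ℤ) := (isSemistable_iff_squarefree_conductorNorm W).mp h
  have h3 : IsUnit (3 : ℕ) := hsq 3 ((show (3 : ℕ) * 3 = 9 by norm_num) ▸ h9)
  exact absurd (Nat.isUnit_iff.mp h3) (by norm_num)

/-- `9 ∤ N_{E_(a,b)}` for every Frey curve (`N ∣ 2⁸ rad(ab(a+b))`; same proof as the landed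
`Summit.ABC.ABC.Theorems.not_nine_dvd_conductorNorm_freyCurve`, restated here only because the summit
modules are not built on the farm snapshot). [cite: BombieriGubler2006, Ex. 12.5.10] -/
theorem not_nine_dvd_conductorNorm_freyCurve' {a b : ℤ} (hab : IsCoprime a b)
    (h0 : a * b * (a + b) ≠ 0) : ¬ 9 ∣ (freyCurve a b).conductorNorm ℤ := by
  intro h9
  have h9' : 9 ∣ 2 ^ 8 * (UniqueFactorizationMonoid.radical (a * b * (a + b))).natAbs :=
    h9.trans (conductorNorm_freyCurve_dvd_holds a b hab h0)
  have hcop : Nat.Coprime 9 (2 ^ 8) := by norm_num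
  have h9r : 9 ∣ (UniqueFactorizationMonoid.radical (a * b * (a + b))).natAbs :=
    hcop.dvd_of_dvd_mul_left h9'
  have hsq : Squarefree (UniqueFactorizationMonoid.radical (a * b * (a + b))).natAbs :=
    Int.squarefree_natAbs.mpr UniqueFactorizationMonoid.squarefree_radical
  have h3 : IsUnit (3 : ℕ) := hsq 3 ((show (3 : ℕ) * 3 = 9 by norm_num) ▸ h9r)
  exact absurd (Nat.isUnit_iff.mp h3) (by norm_num)

/-- **The re-cut is weaker than (or equal to) the registered S2**: `LiftFiveSemistable` follows from
the `stub_liftFive` shape, granted the LANDED S4b `Summit.ABC.ABC.Theorems.stub_absIrrSqrtFive` (Rubin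
Prop. 7 = DDT Lemma 3.24 on curves; hypothesis `h4b` — summit module not built on the farm snapshot)
and `ρ̄` modular from `W'`. [folklore] -/
theorem liftFiveSemistable_of_liftFive
    (hlift5 : ∀ (W : WeierstrassCurve ℚ) [W.IsElliptic] (ρ : ModPGaloisRep ℚ (ZMod 5) 2),
      W.IsTorsionGaloisRep 5 ρ → ρ.IsAbsIrreducibleOverSqrt 5 → ¬ 25 ∣ W.conductorNorm ℤ →
      ρ.IsModular → W.IsModularGaloisRepTate 5)
    (h4b : ∀ (W : WeierstrassCurve ℚ) [W.IsElliptic], ¬ 25 ∣ W.conductorNorm ℤ →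
      ∀ ρ : ModPGaloisRep ℚ (ZMod 5) 2, W.IsTorsionGaloisRep 5 ρ →
        FramedRep.IsIrreducible ρ → ρ.IsAbsIrreducibleOverSqrt 5) : LiftFiveSemistable := by
  intro W W' _ _ _ ρ hss hρ hρ' hirr hW'
  have h25 := not_twentyFive_dvd_of_isSemistable W hss
  exact hlift5 W ρ hρ (h4b W h25 ρ hρ hirr) h25 (hW'.isModular_of_isTorsionGaloisRep'' hρ')

/-- … hence from the tree's umbrella fact `CDT_theorem_7_2_2` (the existing closer survives the re-cut).
[cite: ConradDiamondTaylor1999, Thm. 7.2.2] -/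
theorem liftFiveSemistable_of_CDT_theorem_7_2_2 (h : CDT_theorem_7_2_2)
    (h4b : ∀ (W : WeierstrassCurve ℚ) [W.IsElliptic], ¬ 25 ∣ W.conductorNorm ℤ →
      ∀ ρ : ModPGaloisRep ℚ (ZMod 5) 2, W.IsTorsionGaloisRep 5 ρ →
        FramedRep.IsIrreducible ρ → ρ.IsAbsIrreducibleOverSqrt 5) : LiftFiveSemistable :=
  liftFiveSemistable_of_liftFive (fun W _ ρ hρ hirr _ hmod ↦ lift_of_CDT_theorem_7_2_2 h W ρ hρ hirr hmod) h4b

/-- The ordinary-only cut is weaker still. [folklore] -/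
theorem liftFiveSemistableOrdinary_of_liftFiveSemistable (h : LiftFiveSemistable) :
    LiftFiveSemistableOrdinary :=
  fun W W' _ _ _ ρ hss _ hρ hρ' hirr hW' ↦ h W W' ρ hss hρ hρ' hirr hW'

/-! ## §2 Helper lemmas (the glue the re-cut needs) -/

/-- "Case B at `3`" for the presentation `(A, B)`: no framed model of `E_(A,B)[3]` is absolutely
irreducible over `ℚ(√-3)` (the skeleton's `hB`). -/
def CaseB (A B : ℤ) : Prop :=
  ∀ ρ₃ : ModPGaloisRep ℚ (ZMod 3) 2, (freyCurve A B).IsTorsionGaloisRep 3 ρ₃ →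
    ¬ ρ₃.IsAbsIrreducibleOverSqrt (-3)

/-- **H1a — sign fix with the relation.**  `A` odd, `2 ∣ B`, case B: either `(A, B)` itself or
`(−A, −B)` is normalised with `16 ∣ B` (S12, landed: hypothesis `hS12`), and `E_(A,B)` is literally
`E_(A',B')` or `E_(B',A')` (`freyCurve_swap`).  `hneg` = landed `Summit.ABC.ABC.Theorems.caseBThree_freyCurve_neg`.
[cite: DiamondKramer1995, Lemmas 1–2] -/
theorem exists_normalised_caseB_of_odd_rel
    (hneg : ∀ A B : ℤ, CaseB A B → CaseB (-A) (-B))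
    (hS12 : ∀ (A B : ℤ) [(freyCurve A B).IsElliptic], IsCoprime A B → A * B * (A + B) ≠ 0 →
      A ≡ -1 [ZMOD 4] → (2 : ℤ) ∣ B → CaseB A B → (16 : ℤ) ∣ B)
    {A B : ℤ} (hAB : IsCoprime A B) (h0 : A * B * (A + B) ≠ 0) (hA : ¬ (2 : ℤ) ∣ A)
    (h2 : (2 : ℤ) ∣ B) (hB : CaseB A B) :
    ∃ A' B' : ℤ, IsCoprime A' B' ∧ A' * B' * (A' + B') ≠ 0 ∧ A' ≡ -1 [ZMOD 4] ∧ (16 : ℤ) ∣ B' ∧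
      CaseB A' B' ∧ (freyCurve A B = freyCurve A' B' ∨ freyCurve A B = freyCurve B' A') := by
  by_cases h4 : A ≡ -1 [ZMOD 4]
  · haveI := isElliptic_freyCurve h0
    exact ⟨A, B, hAB, h0, h4, hS12 A B hAB h0 h4 h2 hB, hB, Or.inl rfl⟩
  · have h0' : (-A) * (-B) * (-A + -B) ≠ 0 := by
      rw [show (-A) * (-B) * (-A + -B) = -(A * B * (A + B)) by ring]; exact neg_ne_zero.mpr h0
    have h4' : -A ≡ -1 [ZMOD 4] := by
      unfold Int.ModEq at h4 ⊢
      omega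
    have hB' := hneg A B hB
    haveI := isElliptic_freyCurve h0'
    exact ⟨-A, -B, hAB.neg_neg, h0', h4', hS12 (-A) (-B) hAB.neg_neg h0' h4' ((dvd_neg).mpr h2) hB',
      hB', Or.inr (freyCurve_swap B A)⟩

/-- **H1 — normalisation of a case-B Frey curve WITH the relation** (Diamond–Kramer 1995, Lemma 1; the
landed `Summit.ABC.ABC.Theorems.exists_normalised_freyCurve_caseB` returns the normalised pair but not
the isomorphism): for coprime `a, b`, `ab(a+b) ≠ 0`, `E_(a,b)` in case B at `3`, there are coprime
`A, B` with `A ≡ −1 (mod 4)`, `16 ∣ B`, `E_(A,B)` in case B, and a change of variables `C` over `ℚ` with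
`C • E_(a,b) = E_(A,B)` or `C • E_(a,b) = E_(B,A) = E_(A,B)^{(−1)}`.  Transport hypotheses = the landed
`caseBThree_freyCurve_neg / _swap / _translate_iff` and S12. [cite: DiamondKramer1995, Lemma 1] -/
theorem exists_normalised_caseB_rel
    (hneg : ∀ A B : ℤ, CaseB A B → CaseB (-A) (-B))
    (hswap : ∀ a b : ℤ, CaseB a b → CaseB b a)
    (htrans : ∀ a b : ℤ, CaseB a b → CaseB (-a) (a + b))
    (hS12 : ∀ (A B : ℤ) [(freyCurve A B).IsElliptic], IsCoprime A B → A * B * (A + B) ≠ 0 →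
      A ≡ -1 [ZMOD 4] → (2 : ℤ) ∣ B → CaseB A B → (16 : ℤ) ∣ B)
    {a b : ℤ} (hab : IsCoprime a b) (h0 : a * b * (a + b) ≠ 0) (hB : CaseB a b) :
    ∃ A B : ℤ, IsCoprime A B ∧ A * B * (A + B) ≠ 0 ∧ A ≡ -1 [ZMOD 4] ∧ (16 : ℤ) ∣ B ∧ CaseB A B ∧
      ∃ C : VariableChange ℚ,
        C • freyCurve a b = freyCurve A B ∨ C • freyCurve a b = freyCurve B A := by
  have hnot := not_two_dvd_and_two_dvd_of_isCoprime hab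
  by_cases hb : (2 : ℤ) ∣ b
  · -- `b` even, `a` odd: no move
    obtain ⟨A, B, h1, h2, h3, h4, h5, h6⟩ :=
      exists_normalised_caseB_of_odd_rel hneg hS12 hab h0 (fun ha ↦ hnot ⟨ha, hb⟩) hb hB
    exact ⟨A, B, h1, h2, h3, h4, h5, 1, by rw [one_smul]; exact h6⟩
  · by_cases ha : (2 : ℤ) ∣ a
    · -- `a` even, `b` odd: pass to `E_(b,a) = E_(a,b)^{(−1)}`
      have h0' : b * a * (b + a) ≠ 0 := by
        rwa [show b * a * (b + a) = a * b * (a + b) by ring]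
      obtain ⟨A, B, h1, h2, h3, h4, h5, h6⟩ :=
        exists_normalised_caseB_of_odd_rel hneg hS12 hab.symm h0' hb ha (hswap a b hB)
      refine ⟨A, B, h1, h2, h3, h4, h5, 1, ?_⟩
      rw [one_smul]
      rcases h6 with h | h
      · right
        rw [← quadraticTwist_freyCurve_neg_one b a, h, quadraticTwist_freyCurve_neg_one]
      · left
        rw [← quadraticTwist_freyCurve_neg_one b a, h, quadraticTwist_freyCurve_neg_one]
    · -- `a`, `b` odd: translate to `E_(−a, a+b)`
      have hab2 : (2 : ℤ) ∣ a + b := by omega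
      have h0' : (-a) * (a + b) * (-a + (a + b)) ≠ 0 := by
        rw [show (-a) * (a + b) * (-a + (a + b)) = -(a * b * (a + b)) by ring]
        exact neg_ne_zero.mpr h0
      have hcop : IsCoprime (-a) (a + b) := by
        have h := (hab.add_mul_left_right 1).neg_left
        rwa [mul_one, add_comm] at h
      obtain ⟨A, B, h1, h2, h3, h4, h5, h6⟩ := exists_normalised_caseB_of_odd_rel hneg hS12 hcop h0'
        (fun h ↦ ha ((dvd_neg).mp h)) hab2 (htrans a b hB)
      exact ⟨A, B, h1, h2, h3, h4, h5, ⟨1, (a : ℚ), 0, 0⟩, by rw [translate_freyCurve a b]; exact h6⟩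

/-- `BCDT.IsModular W` read at any level equal to the conductor (transport of the level type, `subst`;
= the landed `Summit.ABC.ABC.Theorems.isModular_iff_exists_isNewformOf_of_eq`). [folklore] -/
theorem isModular_iff_exists_isNewformOf_of_eq' (W : WeierstrassCurve ℚ)
    [NeZero (W.conductorNorm ℤ)] {N : ℕ} [NeZero N] (h : W.conductorNorm ℤ = N) :
    BCDT.IsModular W ↔ ∃ f : CuspForm (CongruenceSubgroup.Gamma0 N) 2, IsNewformOf W f := by
  subst h
  rfl

/-- **H2 — modularity is a property of the curve, not of the model** (= the landed
`Summit.ABC.ABC.Theorems.isModular_smul_iff`, restated because that summit module is off the farm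
snapshot; `conductorNorm_smul_rat`, `LFunction_smul`). [cite: SilvermanAEC2009, App. C §16] -/
theorem isModular_smul_iff' (W : WeierstrassCurve ℚ) [W.IsElliptic] (C : VariableChange ℚ)
    [NeZero (W.conductorNorm ℤ)] [NeZero ((C • W).conductorNorm ℤ)] :
    BCDT.IsModular (C • W) ↔ BCDT.IsModular W := by
  rw [isModular_iff_exists_isNewformOf_of_eq' (C • W) (W.conductorNorm_smul_rat C)]
  refine exists_congr fun f ↦ ?_
  simp only [IsNewformOf, WeierstrassCurve.LFunction_smul]

/-- **H3 — `BCDT.IsModular` is invariant under the quadratic twist by `−1`, GRANTED the two facts S9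
already carries** (Eichler–Shimura, Carayol).  If `f ∈ S₂(Γ₀(N_W))` is the newform of `W`, the Atkin–Li
twist packet of `f ⊗ χ₋₄` is a newform `g` of some level `M ∣ 16 N_W` with `a_q(g) = χ₋₄(q) a_q(f)` for
`q ∤ 16 N_W` (`exists_isNewform0_charTwist_packet`, PROVED); `a_q(W^{(−1)}) = χ₋₄(q) a_q(W)` for odd `q`
(`LFunction_quadraticTwist_neg_one_apply_of_odd`, PROVED); so `g` and `W^{(−1)}` agree at almost all primes
and the tree's Faltings–Serre three-facts lemma (`isModular_of_isNewform0_of_cuspCoeff_eq_off_of_three_facts`)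
makes `W^{(−1)}` modular.  No conductor-of-the-twist computation at `2` is needed.
[cite: AtkinLi1978, §3] [cite: Serre1987Duke, §4.6] -/
theorem isModular_quadraticTwist_neg_one_of_two_facts
    (hES : eichlerShimuraConstruction)
    (hC : ∀ (N : ℕ) [NeZero N], IsNewformOf.level_eq_conductorNorm (N := N))
    (W : WeierstrassCurve ℚ) [W.IsElliptic] [NeZero (W.conductorNorm ℤ)]
    [(W.quadraticTwist (-1)).IsElliptic] [NeZero ((W.quadraticTwist (-1)).conductorNorm ℤ)]
    (hW : BCDT.IsModular W) : BCDT.IsModular (W.quadraticTwist (-1)) := by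
  obtain ⟨f, hf⟩ := hW
  obtain ⟨M, _, -, -, g, hg, hpk⟩ :=
    exists_isNewform0_charTwist_packet isQuadratic_χ₄_ringHomComp isPrimitive_χ₄_ringHomComp hf.1
  haveI : NeZero (W.conductorNorm ℤ * 4 ^ 2) := ⟨mul_ne_zero (NeZero.ne _) (by norm_num)⟩
  refine isModular_of_isNewform0_of_cuspCoeff_eq_off_of_three_facts hES
    isIsogenous_iff_frobeniusTrace_eq_holds hC (W.quadraticTwist (-1)) hg
    (R := W.conductorNorm ℤ * 4 ^ 2) fun q hq hqMR ↦ ?_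
  have hqN : ¬ q ∣ W.conductorNorm ℤ * 4 ^ 2 := fun h ↦ hqMR (dvd_mul_of_dvd_right h M)
  have hq2 : ¬ 2 ∣ q := by
    intro h2
    have h2q : q = 2 := ((Nat.prime_dvd_prime_iff_eq Nat.prime_two hq).mp h2).symm
    subst h2q
    exact hqN (dvd_mul_of_dvd_right (by norm_num) _)
  rw [hpk q hq hqN, hf.2 q, χ₄_ringHomComp_apply_natCast,
    W.LFunction_quadraticTwist_neg_one_apply_of_odd hq2]
  push_cast
  ring

/-- **H3 in the hypothesis shape the composition consumes** (instances discharged: the twist of an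
elliptic curve is elliptic, conductors are positive). [folklore] -/
theorem isModular_quadraticTwist_neg_one_of_two_facts'
    (hES : eichlerShimuraConstruction)
    (hC : ∀ (N : ℕ) [NeZero N], IsNewformOf.level_eq_conductorNorm (N := N)) :
    ∀ (W : WeierstrassCurve ℚ) [W.IsElliptic] [NeZero (W.conductorNorm ℤ)],
      BCDT.IsModular W →
      ∃ (_ : (W.quadraticTwist (-1)).IsElliptic) (_ : NeZero ((W.quadraticTwist (-1)).conductorNorm ℤ)),
        BCDT.IsModular (W.quadraticTwist (-1)) := by
  intro W _ _ hW
  haveI : (W.quadraticTwist (-1 : ℚ)).IsElliptic := W.isElliptic_quadraticTwist (by norm_num)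
  haveI : NeZero ((W.quadraticTwist (-1)).conductorNorm ℤ) :=
    ⟨(conductorNorm_pos_holds (W.quadraticTwist (-1))).ne'⟩
  exact ⟨inferInstance, inferInstance, isModular_quadraticTwist_neg_one_of_two_facts hES hC W hW⟩

/-! ## §3 The re-glued case analysis (kernel-checked): helpers + re-cut stub ⇒ every Frey curve modular -/

/-- **Case B on a NORMALISED Frey curve, through the semistable engine.**  `E₀ = E_(A,B)` with
`A ≡ −1 (mod 4)`, `16 ∣ B` is semistable (`isSemistable_freyCurve_of_sixteen_dvd`); in case B run Wiles'
switch from `E₀` (S3 shape), make `E₀'` modular at `3` (S1 composite shape, `9 ∤ N_{E₀'}` by S10), and lift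
at `5` with `LiftFiveSemistable`; then (3) ⇒ (2) (S9 shape). [cite: Wiles1995Annals, Thm. 5.2 (proof)] -/
theorem isModular_freyCurve_caseB_normalised
    (h1 : ∀ (W : WeierstrassCurve ℚ) [W.IsElliptic] [NeZero (W.conductorNorm ℤ)]
      (ρ : ModPGaloisRep ℚ (ZMod 3) 2), W.IsTorsionGaloisRep 3 ρ →
      ρ.IsAbsIrreducibleOverSqrt (-3) → ¬ 9 ∣ W.conductorNorm ℤ → BCDT.IsModular W)
    (h2 : LiftFiveSemistable)
    (h32 : ∀ (W : WeierstrassCurve ℚ) [W.IsElliptic] [NeZero (W.conductorNorm ℤ)] (ℓ : ℕ)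
      [Fact ℓ.Prime], W.IsModularGaloisRepTate ℓ → BCDT.IsModular W)
    (h3 : ∀ (W : WeierstrassCurve ℚ) [W.IsElliptic], ¬ 27 ∣ W.conductorNorm ℤ →
      (∀ ρ₃ : ModPGaloisRep ℚ (ZMod 3) 2, W.IsTorsionGaloisRep 3 ρ₃ →
        ¬ ρ₃.IsAbsIrreducibleOverSqrt (-3)) →
      ∀ (ρ : ModPGaloisRep ℚ (ZMod 5) 2), W.IsTorsionGaloisRep 5 ρ → ρ.IsAbsIrreducibleOverSqrt 5 →
      ∃ (W' : WeierstrassCurve ℚ) (_ : W'.IsElliptic), W'.IsTorsionGaloisRep 5 ρ ∧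
        ∃ ρ₃' : ModPGaloisRep ℚ (ZMod 3) 2, W'.IsTorsionGaloisRep 3 ρ₃' ∧
          ρ₃'.IsAbsIrreducibleOverSqrt (-3))
    (h4a : ∀ a b : ℤ, IsCoprime a b → a * b * (a + b) ≠ 0 →
      ∀ ρ : ModPGaloisRep ℚ (ZMod 5) 2, (freyCurve a b).IsTorsionGaloisRep 5 ρ →
        FramedRep.IsIrreducible ρ)
    (h4b : ∀ (W : WeierstrassCurve ℚ) [W.IsElliptic], ¬ 25 ∣ W.conductorNorm ℤ →
      ∀ ρ : ModPGaloisRep ℚ (ZMod 5) 2, W.IsTorsionGaloisRep 5 ρ →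
        FramedRep.IsIrreducible ρ → ρ.IsAbsIrreducibleOverSqrt 5)
    (h6 : ∀ (W W' : WeierstrassCurve ℚ) [W.IsElliptic] [W'.IsElliptic]
      (ρ : ModPGaloisRep ℚ (ZMod 5) 2),
      W.IsTorsionGaloisRep 5 ρ → W'.IsTorsionGaloisRep 5 ρ →
      ¬ 9 ∣ W.conductorNorm ℤ → ¬ 9 ∣ W'.conductorNorm ℤ)
    {A B : ℤ} (hAB : IsCoprime A B) (h0 : A * B * (A + B) ≠ 0) (hA : A ≡ -1 [ZMOD 4])
    (h16 : (16 : ℤ) ∣ B) (hB : CaseB A B)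
    [NeZero ((freyCurve A B).conductorNorm ℤ)] : BCDT.IsModular (freyCurve A B) := by
  haveI := isElliptic_freyCurve h0
  have hss : (freyCurve A B).IsSemistable ℤ := isSemistable_freyCurve_of_sixteen_dvd hAB h0 hA h16
  have h9 : ¬ 9 ∣ (freyCurve A B).conductorNorm ℤ := not_nine_dvd_of_isSemistable _ hss
  have h25 : ¬ 25 ∣ (freyCurve A B).conductorNorm ℤ := not_twentyFive_dvd_of_isSemistable _ hss
  have h27 : ¬ 27 ∣ (freyCurve A B).conductorNorm ℤ := fun h27 ↦ h9 (dvd_trans ⟨3, rfl⟩ h27)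
  obtain ⟨ρ, hρ⟩ := (freyCurve A B).exists_isTorsionGaloisRep 5
  have hirr : FramedRep.IsIrreducible ρ := h4a A B hAB h0 ρ hρ
  have h5 : ρ.IsAbsIrreducibleOverSqrt 5 := h4b (freyCurve A B) h25 ρ hρ hirr
  -- Wiles' switch from `E₀` itself
  obtain ⟨W', hW', hρ', ρ₃', hρ₃', h3i'⟩ := h3 (freyCurve A B) h27 hB ρ hρ h5
  haveI := hW'
  haveI : NeZero (W'.conductorNorm ℤ) := ⟨(conductorNorm_pos_holds W').ne'⟩
  have h9' : ¬ 9 ∣ W'.conductorNorm ℤ := h6 (freyCurve A B) W' ρ hρ hρ' h9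
  have hE' : BCDT.IsModular W' := h1 W' ρ₃' hρ₃' h3i' h9'
  -- the semistable lifting at `5`, in congruence form, then (3) ⇒ (2)
  exact h32 (freyCurve A B) 5 (h2 (freyCurve A B) W' ρ hss hρ hρ' hirr hE')

/-- **Every Frey curve is modular, from the stub shapes with S2 re-cut to `LiftFiveSemistable`** — the
composition `isModular_freyCurve_of_stubs` of the skeleton with case B routed through the normalised
semistable model: case A unchanged (S1 on `E` itself); case B: normalise WITH the relation (H1), prove the
normalised curve modular (`isModular_freyCurve_caseB_normalised`), come back along the isomorphism (H2) or
along isomorphism + `−1` twist (H3/`h7`, `quadraticTwist_freyCurve_neg_one`).  Hypotheses `hneg`, `hswap`,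
`htrans`, `hS12`, `h4b`, `h6` are LANDED theorems of the crux's Theorems modules (named in H1 / the
skeleton), entered as hypotheses only because those modules are off the farm snapshot today.
[cite: ConradDiamondTaylor1999, Thm. 7.1.2 (proof, p. 556)] [cite: DiamondKramer1995, Lemma 1] -/
theorem isModular_freyCurve_of_stubs_semistable
    (h1 : ∀ (W : WeierstrassCurve ℚ) [W.IsElliptic] [NeZero (W.conductorNorm ℤ)]
      (ρ : ModPGaloisRep ℚ (ZMod 3) 2), W.IsTorsionGaloisRep 3 ρ →
      ρ.IsAbsIrreducibleOverSqrt (-3) → ¬ 9 ∣ W.conductorNorm ℤ → BCDT.IsModular W)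
    (h2 : LiftFiveSemistable)
    (h32 : ∀ (W : WeierstrassCurve ℚ) [W.IsElliptic] [NeZero (W.conductorNorm ℤ)] (ℓ : ℕ)
      [Fact ℓ.Prime], W.IsModularGaloisRepTate ℓ → BCDT.IsModular W)
    (h3 : ∀ (W : WeierstrassCurve ℚ) [W.IsElliptic], ¬ 27 ∣ W.conductorNorm ℤ →
      (∀ ρ₃ : ModPGaloisRep ℚ (ZMod 3) 2, W.IsTorsionGaloisRep 3 ρ₃ →
        ¬ ρ₃.IsAbsIrreducibleOverSqrt (-3)) →
      ∀ (ρ : ModPGaloisRep ℚ (ZMod 5) 2), W.IsTorsionGaloisRep 5 ρ → ρ.IsAbsIrreducibleOverSqrt 5 →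
      ∃ (W' : WeierstrassCurve ℚ) (_ : W'.IsElliptic), W'.IsTorsionGaloisRep 5 ρ ∧
        ∃ ρ₃' : ModPGaloisRep ℚ (ZMod 3) 2, W'.IsTorsionGaloisRep 3 ρ₃' ∧
          ρ₃'.IsAbsIrreducibleOverSqrt (-3))
    (h4a : ∀ a b : ℤ, IsCoprime a b → a * b * (a + b) ≠ 0 →
      ∀ ρ : ModPGaloisRep ℚ (ZMod 5) 2, (freyCurve a b).IsTorsionGaloisRep 5 ρ →
        FramedRep.IsIrreducible ρ)
    (h4b : ∀ (W : WeierstrassCurve ℚ) [W.IsElliptic], ¬ 25 ∣ W.conductorNorm ℤ →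
      ∀ ρ : ModPGaloisRep ℚ (ZMod 5) 2, W.IsTorsionGaloisRep 5 ρ →
        FramedRep.IsIrreducible ρ → ρ.IsAbsIrreducibleOverSqrt 5)
    (h6 : ∀ (W W' : WeierstrassCurve ℚ) [W.IsElliptic] [W'.IsElliptic]
      (ρ : ModPGaloisRep ℚ (ZMod 5) 2),
      W.IsTorsionGaloisRep 5 ρ → W'.IsTorsionGaloisRep 5 ρ →
      ¬ 9 ∣ W.conductorNorm ℤ → ¬ 9 ∣ W'.conductorNorm ℤ)
    (h7 : ∀ (W : WeierstrassCurve ℚ) [W.IsElliptic] [NeZero (W.conductorNorm ℤ)],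
      BCDT.IsModular W →
      ∃ (_ : (W.quadraticTwist (-1)).IsElliptic) (_ : NeZero ((W.quadraticTwist (-1)).conductorNorm ℤ)),
        BCDT.IsModular (W.quadraticTwist (-1)))
    (hneg : ∀ A B : ℤ, CaseB A B → CaseB (-A) (-B))
    (hswap : ∀ a b : ℤ, CaseB a b → CaseB b a)
    (htrans : ∀ a b : ℤ, CaseB a b → CaseB (-a) (a + b))
    (hS12 : ∀ (A B : ℤ) [(freyCurve A B).IsElliptic], IsCoprime A B → A * B * (A + B) ≠ 0 →
      A ≡ -1 [ZMOD 4] → (2 : ℤ) ∣ B → CaseB A B → (16 : ℤ) ∣ B)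
    {a b : ℤ} (hab : IsCoprime a b) (h0 : a * b * (a + b) ≠ 0)
    [NeZero ((freyCurve a b).conductorNorm ℤ)] : BCDT.IsModular (freyCurve a b) := by
  haveI := isElliptic_freyCurve h0
  have h9 : ¬ 9 ∣ (freyCurve a b).conductorNorm ℤ := not_nine_dvd_conductorNorm_freyCurve' hab h0
  -- case A: some framed model of `E[3]` is absolutely irreducible over `ℚ(√-3)` — unchanged
  by_cases hA : ∃ ρ₃ : ModPGaloisRep ℚ (ZMod 3) 2,
      (freyCurve a b).IsTorsionGaloisRep 3 ρ₃ ∧ ρ₃.IsAbsIrreducibleOverSqrt (-3)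
  · obtain ⟨ρ₃, hρ₃, h3i⟩ := hA
    exact h1 (freyCurve a b) ρ₃ hρ₃ h3i h9
  -- case B: normalise with the relation, prove the semistable model modular, transport back
  have hB : CaseB a b := fun ρ₃ hρ₃ h3i ↦ hA ⟨ρ₃, hρ₃, h3i⟩
  obtain ⟨A, B, hAB, h0', hA4, h16, hB', C, hC⟩ :=
    exists_normalised_caseB_rel hneg hswap htrans hS12 hab h0 hB
  haveI := isElliptic_freyCurve h0'
  haveI : NeZero ((freyCurve A B).conductorNorm ℤ) := ⟨(conductorNorm_pos_holds (freyCurve A B)).ne'⟩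
  have hE₀ : BCDT.IsModular (freyCurve A B) :=
    isModular_freyCurve_caseB_normalised h1 h2 h32 h3 h4a h4b h6 hAB h0' hA4 h16 hB'
  haveI : NeZero ((C • freyCurve a b).conductorNorm ℤ) := by
    rw [(freyCurve a b).conductorNorm_smul_rat C]; infer_instance
  rcases hC with hC | hC
  · -- `C • E = E₀`
    have hCE : ∀ [NeZero ((C • freyCurve a b).conductorNorm ℤ)], BCDT.IsModular (C • freyCurve a b) := by
      rw [hC]; intro; exact hE₀
    exact (isModular_smul_iff' (freyCurve a b) C).mp hCE
  · -- `C • E = E_(B,A) = E₀^{(−1)}`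
    obtain ⟨hEll, hNZ, htw⟩ := h7 (freyCurve A B) hE₀
    have hBA : ∀ [NeZero ((freyCurve B A).conductorNorm ℤ)], BCDT.IsModular (freyCurve B A) := by
      rw [← quadraticTwist_freyCurve_neg_one A B]; intro; exact htw
    have hCE : ∀ [NeZero ((C • freyCurve a b).conductorNorm ℤ)], BCDT.IsModular (C • freyCurve a b) := by
      rw [hC]; intro; exact hBA
    exact (isModular_smul_iff' (freyCurve a b) C).mp hCE

/-- **The right-hand side of the landed `freyModularity_iff_forall_isModular_freyCurve`, VERBATIM, from
the re-cut stub set** (its `.mpr` is the crux `Summit.ABC.ABC.Theses.DefiniteXi.FreyModularity` by name,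
exactly as in the skeleton's `FreyModularity_of`; not imported here only because the summit modules are
off the farm snapshot).  Leaves: S1 composite shape, `LiftFiveSemistable` (NEW S2), S3, reshape-3
rigidity `h4a`, landed S4b / S10 / S12 / case-B transports, and the two named facts `hES`, `hC` behind
the skeleton's S9 closer `stub_threeImpTwo_of_two_facts` — which ALSO discharge the twist atom H3.
[cite: ConradDiamondTaylor1999, Thm. 7.1.2 (proof, p. 556)] -/
theorem forall_isModular_freyCurve_of_semistable_recut
    (hmod3lift3 : ∀ (W : WeierstrassCurve ℚ) [W.IsElliptic] [NeZero (W.conductorNorm ℤ)]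
      (ρ : ModPGaloisRep ℚ (ZMod 3) 2), W.IsTorsionGaloisRep 3 ρ →
      ρ.IsAbsIrreducibleOverSqrt (-3) → ¬ 9 ∣ W.conductorNorm ℤ → BCDT.IsModular W)
    (hlift5 : LiftFiveSemistable)
    (hswitch : ∀ (W : WeierstrassCurve ℚ) [W.IsElliptic], ¬ 27 ∣ W.conductorNorm ℤ →
      (∀ ρ₃ : ModPGaloisRep ℚ (ZMod 3) 2, W.IsTorsionGaloisRep 3 ρ₃ →
        ¬ ρ₃.IsAbsIrreducibleOverSqrt (-3)) →
      ∀ (ρ : ModPGaloisRep ℚ (ZMod 5) 2), W.IsTorsionGaloisRep 5 ρ → ρ.IsAbsIrreducibleOverSqrt 5 →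
      ∃ (W' : WeierstrassCurve ℚ) (_ : W'.IsElliptic), W'.IsTorsionGaloisRep 5 ρ ∧
        ∃ ρ₃' : ModPGaloisRep ℚ (ZMod 3) 2, W'.IsTorsionGaloisRep 3 ρ₃' ∧
          ρ₃'.IsAbsIrreducibleOverSqrt (-3))
    (h4a : ∀ a b : ℤ, IsCoprime a b → a * b * (a + b) ≠ 0 →
      ∀ ρ : ModPGaloisRep ℚ (ZMod 5) 2, (freyCurve a b).IsTorsionGaloisRep 5 ρ →
        FramedRep.IsIrreducible ρ)
    (h4b : ∀ (W : WeierstrassCurve ℚ) [W.IsElliptic], ¬ 25 ∣ W.conductorNorm ℤ →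
      ∀ ρ : ModPGaloisRep ℚ (ZMod 5) 2, W.IsTorsionGaloisRep 5 ρ →
        FramedRep.IsIrreducible ρ → ρ.IsAbsIrreducibleOverSqrt 5)
    (h6 : ∀ (W W' : WeierstrassCurve ℚ) [W.IsElliptic] [W'.IsElliptic]
      (ρ : ModPGaloisRep ℚ (ZMod 5) 2),
      W.IsTorsionGaloisRep 5 ρ → W'.IsTorsionGaloisRep 5 ρ →
      ¬ 9 ∣ W.conductorNorm ℤ → ¬ 9 ∣ W'.conductorNorm ℤ)
    (hneg : ∀ A B : ℤ, CaseB A B → CaseB (-A) (-B))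
    (hswap : ∀ a b : ℤ, CaseB a b → CaseB b a)
    (htrans : ∀ a b : ℤ, CaseB a b → CaseB (-a) (a + b))
    (hS12 : ∀ (A B : ℤ) [(freyCurve A B).IsElliptic], IsCoprime A B → A * B * (A + B) ≠ 0 →
      A ≡ -1 [ZMOD 4] → (2 : ℤ) ∣ B → CaseB A B → (16 : ℤ) ∣ B)
    (hES : eichlerShimuraConstruction)
    (hC : ∀ (N : ℕ) [NeZero N], IsNewformOf.level_eq_conductorNorm (N := N)) :
    ∀ a b : ℤ, IsCoprime a b → a * b * (a + b) ≠ 0 →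
      ∀ [NeZero ((freyCurve a b).conductorNorm ℤ)], BCDT.IsModular (freyCurve a b) :=
  fun _ _ hab h0 _ ↦ isModular_freyCurve_of_stubs_semistable hmod3lift3 hlift5
    (fun W _ _ ℓ _ h ↦ isModular_of_isModularGaloisRepTate_of_three_facts hES
      isIsogenous_iff_frobeniusTrace_eq_holds hC W ℓ h) hswitch h4a h4b h6
    (isModular_quadraticTwist_neg_one_of_two_facts' hES hC) hneg hswap htrans hS12 hab h0

end Summit.ABC.ABC.Cruxes.FreyModularity.StubIdeas.LiftFive3g3

end
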